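import Mathlib
import Summits.AnomalousDissipation.AnomalousDissipation.Theorems.SoloBlindNewtonContraction

/-!
# Route `FilamentSkeletonRss` · `SkeletonJ1L` (stmt-NavierStokesRegularity-23296) / heart `TangentSkeletonNearStraightL` (23320) —
# brick for the NEWTON CLOSING step: simplified Newton with a RIGHT inverse (underdetermined problems)

Every existence line of record for the heart closes by a Newton step from an approximate (quasi-tangent) skeleton: line (C)
`child_tangent_analytic_strip_L` PHASE 2 step (iv) («Newton–Kantorovich from residual 2^{-cΓ^{1/4}}») and the alt line `fuchsian_newton_L`
stub (N) `NewtonClosingL : QuasiTangentAnalyticL → AnalyticRightInverseL → TangentSkeletonNearStraightLS` («simplified Newton (chord; R₀ frozen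
at the quasi-skeleton)»).  The linearised tangency-defect map there is WIDE (more unknowns than equations: a RIGHT inverse with a polynomial bound
is what (R)/(R♯) deliver), so the abstract tool is the right-inverse form of the simplified-Newton contraction: solve `F(z₀ + R y) = 0` for `y`
in the TARGET space by the chord map `y ↦ y − F(z₀ + R y)`.

This file derives that form (plus the Kantorovich `ω`-version) from the landed injective-approximate-inverse theorem
`Summit.AnomalousDissipation.AnomalousDissipation.Theorems.newton_contraction` (solo-blind kernel #110) applied on the target space with
`A = id`:
* `newton_rightInverse` — `F : E → G` between real Banach spaces, `R : G →L[ℝ] E`, `‖id_G − F′(z₀ + R y) ∘ R‖ ≤ κ < 1` for `‖y‖ ≤ r`,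
  `‖F z₀‖ ≤ η`, `η + κ r ≤ r` ⇒ a zero `z = z₀ + R y` of `F` with `‖y‖ ≤ η/(1 − κ)` (so `‖z − z₀‖ ≤ ‖R‖·η/(1 − κ)`), unique among
  `z₀ + R·(closedBall 0 r)`;
* `newton_rightInverse_kantorovich` — the `ω`-form: `‖id_G − F′(z₀ + R y) ∘ R‖ ≤ ω‖y‖` on `‖y‖ ≤ 2η` and `ωη ≤ 1/4`.
Pure functional analysis; `--supports stmt-NavierStokesRegularity-23296` (equally 23320 / 23610).
HONEST FRAMING: an abstract lemma for a plan about a HYPOTHETICAL filament skeleton on the NEGATIVE side of a MODEL route; no stub of the heart is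
closed by it; nothing here bears on Navier–Stokes regularity or blow-up.
-/

set_option linter.dupNamespace false

namespace Summit.NavierStokesRegularity.NavierStokesRegularity.Theorems.NewtonRightInverse

open Set Metric Function
open Summit.AnomalousDissipation.AnomalousDissipation.Theorems (newton_contraction newton_kantorovich_affine)

variable {E G : Type*} [NormedAddCommGroup E] [NormedSpace ℝ E]
  [NormedAddCommGroup G] [NormedSpace ℝ G] [CompleteSpace G]

omit [CompleteSpace G] in
/-- Chain rule for the chord parametrisation `y ↦ F (z₀ + R y)`. [folklore] -/
theorem hasFDerivAt_comp_affine {F : E → G} {F'x : E →L[ℝ] G} {R : G →L[ℝ] E} {z₀ : E} {y : G}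
    (hder : HasFDerivAt F F'x (z₀ + R y)) :
    HasFDerivAt (fun y : G => F (z₀ + R y)) (F'x.comp R) y := by
  have haff : HasFDerivAt (fun y : G => z₀ + R y) R y := by
    simpa using (R.hasFDerivAt (x := y)).const_add z₀
  exact hder.comp y haff

/-- **Simplified Newton with a RIGHT inverse.**  Let `F : E → G` (real normed spaces, `G` complete), `z₀ ∈ E`, `R : G →L[ℝ] E`, and suppose
that on the target ball `‖y‖ ≤ r` the map `F` is differentiable at `z₀ + R y` with `‖id − F′(z₀ + R y) ∘ R‖ ≤ κ < 1`, that `‖F z₀‖ ≤ η`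
and `η + κ r ≤ r`.  Then `F` has a zero of the form `z₀ + R y`, `‖y‖ ≤ r`, with `‖y‖ ≤ η/(1 − κ)`, and `y` is the only such parameter in
the ball. [folklore] -/
theorem newton_rightInverse {F : E → G} {F' : E → E →L[ℝ] G} {R : G →L[ℝ] E} {z₀ : E} {r κ η : ℝ}
    (hder : ∀ y ∈ closedBall (0 : G) r, HasFDerivAt F (F' (z₀ + R y)) (z₀ + R y))
    (hκ0 : 0 ≤ κ) (hκ1 : κ < 1)
    (hκ : ∀ y ∈ closedBall (0 : G) r, ‖ContinuousLinearMap.id ℝ G - (F' (z₀ + R y)).comp R‖ ≤ κ)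
    (hη : ‖F z₀‖ ≤ η) (hball : η + κ * r ≤ r) :
    ∃ y ∈ closedBall (0 : G) r, F (z₀ + R y) = 0 ∧ ‖y‖ ≤ η / (1 - κ) ∧
      ∀ y' ∈ closedBall (0 : G) r, F (z₀ + R y') = 0 → y' = y := by
  have h := newton_contraction (E := G) (G := G) (F := fun y : G => F (z₀ + R y))
    (F' := fun y => (F' (z₀ + R y)).comp R) (A := ContinuousLinearMap.id ℝ G) (z₀ := 0) (r := r) (κ := κ) (η := η)
    (fun y hy => hasFDerivAt_comp_affine (hder y hy)) (fun a b hab => hab) hκ0 hκ1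
    (fun y hy => by rw [ContinuousLinearMap.id_comp]; exact hκ y hy)
    (by simpa using hη) hball
  obtain ⟨y, hy, hzero, hbound, huniq⟩ := h
  refine ⟨y, hy, hzero, by simpa using hbound, fun y' hy' h' => huniq y' hy' h'⟩

/-- The zero found by `newton_rightInverse`, in the state space: `‖z − z₀‖ ≤ ‖R‖·η/(1 − κ)`. [folklore] -/
theorem newton_rightInverse_state {F : E → G} {F' : E → E →L[ℝ] G} {R : G →L[ℝ] E} {z₀ : E} {r κ η : ℝ}
    (hder : ∀ y ∈ closedBall (0 : G) r, HasFDerivAt F (F' (z₀ + R y)) (z₀ + R y))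
    (hκ0 : 0 ≤ κ) (hκ1 : κ < 1)
    (hκ : ∀ y ∈ closedBall (0 : G) r, ‖ContinuousLinearMap.id ℝ G - (F' (z₀ + R y)).comp R‖ ≤ κ)
    (hη : ‖F z₀‖ ≤ η) (hball : η + κ * r ≤ r) :
    ∃ z : E, F z = 0 ∧ ‖z - z₀‖ ≤ ‖R‖ * (η / (1 - κ)) := by
  obtain ⟨y, -, hzero, hbound, -⟩ := newton_rightInverse hder hκ0 hκ1 hκ hη hball
  refine ⟨z₀ + R y, hzero, ?_⟩
  rw [add_sub_cancel_left]
  exact (R.le_opNorm y).trans (mul_le_mul_of_nonneg_left hbound (norm_nonneg _))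

/-- **Right-inverse Newton–Kantorovich, affine-covariant `ω`-form:** `‖id − F′(z₀ + R y) ∘ R‖ ≤ ω‖y‖` on `‖y‖ ≤ 2η`, `‖F z₀‖ ≤ η` and
`ωη ≤ 1/4` give a zero `z₀ + R y` with `‖y‖ ≤ 2η`, unique among such parameters. [folklore] -/
theorem newton_rightInverse_kantorovich {F : E → G} {F' : E → E →L[ℝ] G} {R : G →L[ℝ] E} {z₀ : E} {ω η : ℝ}
    (hder : ∀ y ∈ closedBall (0 : G) (2 * η), HasFDerivAt F (F' (z₀ + R y)) (z₀ + R y))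
    (hω0 : 0 ≤ ω)
    (hω : ∀ y ∈ closedBall (0 : G) (2 * η), ‖ContinuousLinearMap.id ℝ G - (F' (z₀ + R y)).comp R‖ ≤ ω * ‖y‖)
    (hη : ‖F z₀‖ ≤ η) (hh : ω * η ≤ 1 / 4) :
    ∃ y ∈ closedBall (0 : G) (2 * η), F (z₀ + R y) = 0 ∧
      ∀ y' ∈ closedBall (0 : G) (2 * η), F (z₀ + R y') = 0 → y' = y := by
  have h := newton_kantorovich_affine (E := G) (G := G) (F := fun y : G => F (z₀ + R y))
    (F' := fun y => (F' (z₀ + R y)).comp R) (A := ContinuousLinearMap.id ℝ G) (z₀ := 0) (ω := ω) (η := η)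
    (fun y hy => hasFDerivAt_comp_affine (hder y hy)) (fun a b hab => hab) hω0
    (fun y hy => by rw [ContinuousLinearMap.id_comp]; simpa using hω y hy)
    (by simpa using hη) hh
  obtain ⟨y, hy, hzero, huniq⟩ := h
  exact ⟨y, hy, hzero, fun y' hy' h' => huniq y' hy' h'⟩

end Summit.NavierStokesRegularity.NavierStokesRegularity.Theorems.NewtonRightInverse
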